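import Literature.Combinatorics.Sahi2008.FKG
import Literature.Combinatorics.Sahi2008.Percolation
import Literature.Combinatorics.Sahi2008.CumulationCone
import Literature.Combinatorics.Sahi2008.Symmetry
import Summits.CriticalPhenomena.PercolationContinuityZ3.Theorems.PercNearOneGluingNoHeavyLowerTailSahiChainTriangleE6
import Mathlib.Tactic.Linarith
import Mathlib.Tactic.Ring
import HarnessLib

/-!
# `NoHeavyLowerTail` (crux stmt-CriticalPhenomena-4575), P2 — the triangle class with a CROSS-SUPERMODULAR member: Sahi's `C_3`

Memo SAHI-ROUTE.md §4.20 (seat `prim-masterthm-p2`, gen 7; `--supports stmt-CriticalPhenomena-4575`).  No `sorry`, no named facts,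
standard axioms.

SETTING ("class T", the triangle-block class of the one-arm programme): three finite distributive lattices `α, β, γ` carrying FKG
probability weights `wA, wB, wC` (log-supermodular, e.g. product measures on cubes, or ANY law on a chain), and nonnegative
coordinatewise monotone `f : γ → α → ℝ`, `g : γ → β → ℝ`, `h : α → β → ℝ` — each member sees two of the three independent blocks.
Sahi's third-order positivity `E_3(f,g,h) ≥ 0` under the product weight on `α × β × γ` is OPEN for this class in general (it is the
law-level form of the comb inequality `TRI ≥ 0`; proved strata in the tree: a block of dimension `≤ 1` (thin edge, P5/lf-1), `γ` a chain
(`SahiChainCubeTriangle`, P2 gen 6)).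

THE THEOREM (`sahiE_three_nonneg_of_crossSupermodular`): if ONE member, say `f`, is CROSS-SUPERMODULAR between its two blocks —
`a ↦ f c' a − f c a` is monotone for `c ≤ c'` (for `{0,1}`-valued increasing `f` on cubes this means exactly `f(c,a) = φ(c)ψ(a)`) — then
`E_3(f,g,h) ≥ 0`, for ALL block lattices and ALL FKG weights.  PROOF (three applications of FKG, no clones):
`E_3 = T₁ + T₂ + T₃` with `T₁ = E[fgh] − E f·E[gh] ≥ 0` (FKG on `α`, then on `γ`), `T₂ = E[fgh] − E_{c,a}[f·G_C(c)·H_A(a)]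
= E_{c,a}[f·Cov_b(g(c,·),h(a,·))] ≥ 0` (FKG on `β`), and `T₃ = E_{c,a}[f G_C H_A] − E g·E[fh] − E h·E[fg] + E f E g E h = Cov_c(G_C, φ)`,
`φ(c) = Cov_a(f(c,·), H_A) ≥ 0` and increasing in `c` by cross-supermodularity (FKG on `α`), so `T₃ ≥ 0` (FKG on `γ`).  Here
`G_C(c) = E_b g(c,b)`, `H_A(a) = E_b h(a,b)`.  (In the gluing-cube language of SAHI-ROUTE §4.16(d3): `E_3 = rect(A,C) + [τ(ABC) − τ(AC)]
+ [τ(ABC) − τ(B)]`, `rect(A,C) = τ(AC) − τ(A) − τ(C) + τ(∅) = E[f·G̃_C·H̃_A]`.)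
Corollaries: a product member `f(c,a) = φ(c)ψ(a)` (`sahiE_three_nonneg_of_productMember`); three Boolean cubes with product
measures (`sahiE_three_nonneg_cubes_of_crossSupermodular`).  By the symmetry of the triangle any one cross-supermodular member suffices
(relabel the blocks); only the `f`-form is spelled out.
-/

noncomputable section

open scoped Classical

namespace Summit.CriticalPhenomena.PercolationContinuityZ3.Theorems

namespace SahiTriangleSupermodular

open Finset
open Literature.Combinatorics.Sahi2008
open SahiChainTriangle (ex_prod3 drop_a drop_b drop_c)

section Main

variable {α β γ : Type} [Fintype α] [Fintype β] [Fintype γ]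
  (wA : α → ℝ) (wB : β → ℝ) (wC : γ → ℝ) (f : γ → α → ℝ) (g : γ → β → ℝ) (h : α → β → ℝ)

/-- `F_C(c) = E_a f(c,a)`, the `α`-marginal of `f`. [this work] -/
def FC (c : γ) : ℝ := ∑ a, wA a * f c a
/-- `G_C(c) = E_b g(c,b)`, the `β`-marginal of `g`. [this work] -/
def GC (c : γ) : ℝ := ∑ b, wB b * g c b
/-- `G_B(b) = E_c g(c,b)`, the `γ`-marginal of `g`. [this work] -/
def GB (b : β) : ℝ := ∑ c, wC c * g c b
/-- `H_A(a) = E_b h(a,b)`, the `β`-marginal of `h`. [this work] -/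
def HA (a : α) : ℝ := ∑ b, wB b * h a b
/-- `H_B(b) = E_a h(a,b)`, the `α`-marginal of `h`. [this work] -/
def HB (b : β) : ℝ := ∑ a, wA a * h a b
/-- `φ(c) = Cov_a(f(c,·), H_A) = E_a[f(c,a)H_A(a)] − F_C(c)·E h`. [this work] -/
def phi (c : γ) : ℝ := (∑ a, wA a * (f c a * HA wB h a)) - FC wA f c * ∑ a, wA a * HA wB h a

/-- FKG in `Σ`-form: `(Σ μ u)(Σ μ v) ≤ Σ μ (u v)` for nonnegative monotone `u, v` under an FKG probability weight. [folklore] -/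
theorem fkg_sum {δ : Type} [Fintype δ] [DistribLattice δ] {μ : δ → ℝ} (hμ : IsFKGMeasure μ) {u v : δ → ℝ}
    (hu0 : ∀ x, 0 ≤ u x) (hv0 : ∀ x, 0 ≤ v x) (hum : Monotone u) (hvm : Monotone v) :
    (∑ x, μ x * u x) * (∑ x, μ x * v x) ≤ ∑ x, μ x * (u x * v x) := by
  have h1 := ex_mul_ex_le_ex_mul hμ hu0 hv0 hum hvm
  simpa only [ex, Pi.mul_apply] using h1

variable {wA wB wC f g h}

omit [Fintype γ] in
/-- `F_C` is nonnegative. [this work] -/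
theorem FC_nonneg (hA0 : ∀ a, 0 ≤ wA a) (hf0 : ∀ c a, 0 ≤ f c a) (c : γ) : 0 ≤ FC wA f c :=
  sum_nonneg fun a _ => mul_nonneg (hA0 a) (hf0 c a)

omit [Fintype γ] in
/-- `F_C` is monotone. [this work] -/
theorem FC_mono [Preorder γ] (hA0 : ∀ a, 0 ≤ wA a) (hfc : ∀ a, Monotone (fun c => f c a)) : Monotone (FC wA f) :=
  fun _ _ hcc => sum_le_sum fun a _ => mul_le_mul_of_nonneg_left (hfc a hcc) (hA0 a)

omit [Fintype γ] in
/-- `G_C` is nonnegative. [this work] -/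
theorem GC_nonneg (hB0 : ∀ b, 0 ≤ wB b) (hg0 : ∀ c b, 0 ≤ g c b) (c : γ) : 0 ≤ GC wB g c :=
  sum_nonneg fun b _ => mul_nonneg (hB0 b) (hg0 c b)

omit [Fintype γ] in
/-- `G_C` is monotone. [this work] -/
theorem GC_mono [Preorder γ] (hB0 : ∀ b, 0 ≤ wB b) (hgc : ∀ b, Monotone (fun c => g c b)) : Monotone (GC wB g) :=
  fun _ _ hcc => sum_le_sum fun b _ => mul_le_mul_of_nonneg_left (hgc b hcc) (hB0 b)

omit [Fintype α] in
/-- `H_A` is nonnegative. [this work] -/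
theorem HA_nonneg (hB0 : ∀ b, 0 ≤ wB b) (hh0 : ∀ a b, 0 ≤ h a b) (a : α) : 0 ≤ HA wB h a :=
  sum_nonneg fun b _ => mul_nonneg (hB0 b) (hh0 a b)

omit [Fintype α] in
/-- `H_A` is monotone. [this work] -/
theorem HA_mono [Preorder α] (hB0 : ∀ b, 0 ≤ wB b) (hha : ∀ b, Monotone (fun a => h a b)) : Monotone (HA wB h) :=
  fun _ _ haa => sum_le_sum fun b _ => mul_le_mul_of_nonneg_left (hha b haa) (hB0 b)

omit [Fintype β] in
/-- `H_B` is nonnegative. [this work] -/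
theorem HB_nonneg (hA0 : ∀ a, 0 ≤ wA a) (hh0 : ∀ a b, 0 ≤ h a b) (b : β) : 0 ≤ HB wA h b :=
  sum_nonneg fun a _ => mul_nonneg (hA0 a) (hh0 a b)

omit [Fintype γ] in
/-- `φ ≥ 0`: `E_a[f(c,a)H_A(a)] ≥ F_C(c)·E_a H_A` (FKG on `α`). [this work] -/
theorem phi_nonneg [DistribLattice α] [Preorder β] (hA : IsFKGMeasure wA) (hB0 : ∀ b, 0 ≤ wB b)
    (hf0 : ∀ c a, 0 ≤ f c a) (hh0 : ∀ a b, 0 ≤ h a b) (hfa : ∀ c, Monotone (f c))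
    (hha : ∀ b, Monotone (fun a => h a b)) (c : γ) : 0 ≤ phi wA wB f h c := by
  unfold phi FC
  have := fkg_sum hA (hf0 c) (HA_nonneg hB0 hh0) (hfa c) (HA_mono hB0 hha)
  linarith

omit [Fintype γ] in
/-- `φ` is monotone in `c`: `φ(c') − φ(c) = Cov_a(f(c',·) − f(c,·), H_A) ≥ 0` by CROSS-SUPERMODULARITY and FKG on `α`. [this work] -/
theorem phi_mono [DistribLattice α] [Preorder β] [Preorder γ] (hA : IsFKGMeasure wA) (hB0 : ∀ b, 0 ≤ wB b)
    (hh0 : ∀ a b, 0 ≤ h a b) (hfc : ∀ a, Monotone (fun c => f c a)) (hha : ∀ b, Monotone (fun a => h a b))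
    (hsm : ∀ c c', c ≤ c' → Monotone (fun a => f c' a - f c a)) : Monotone (phi wA wB f h) := by
  intro c c' hcc
  have key := fkg_sum hA (u := fun a => f c' a - f c a) (v := HA wB h)
    (fun a => sub_nonneg.mpr (hfc a hcc)) (HA_nonneg hB0 hh0) (hsm c c' hcc) (HA_mono hB0 hha)
  have e1 : (∑ a, wA a * (f c' a - f c a)) = FC wA f c' - FC wA f c := by
    simp only [FC, ← sum_sub_distrib]; exact sum_congr rfl fun a _ => by ring
  have e2 : (∑ a, wA a * ((f c' a - f c a) * HA wB h a)) =
      (∑ a, wA a * (f c' a * HA wB h a)) - ∑ a, wA a * (f c a * HA wB h a) := by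
    rw [← sum_sub_distrib]; exact sum_congr rfl fun a _ => by ring
  rw [e1, e2] at key
  unfold phi
  nlinarith [key]

/-! ### The three lower bounds and the theorem -/

omit [Fintype α] [Fintype β] [Fintype γ] in
/-- Re-nesting `Σ_a Σ_b Σ_c → Σ_b Σ_c Σ_a` (plumbing). [folklore] -/
theorem sum3_bca [Fintype α] [Fintype β] [Fintype γ] (Φ : α → β → γ → ℝ) :
    (∑ a, ∑ b, ∑ c, Φ a b c) = ∑ b, ∑ c, ∑ a, Φ a b c := by
  rw [sum_comm]; exact sum_congr rfl fun _ _ => sum_comm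

omit [Fintype α] [Fintype β] [Fintype γ] in
/-- Re-nesting `Σ_a Σ_b Σ_c → Σ_a Σ_c Σ_b` (plumbing). [folklore] -/
theorem sum3_acb [Fintype α] [Fintype β] [Fintype γ] (Φ : α → β → γ → ℝ) :
    (∑ a, ∑ b, ∑ c, Φ a b c) = ∑ a, ∑ c, ∑ b, Φ a b c :=
  sum_congr rfl fun _ _ => sum_comm

omit [Fintype α] [Fintype β] [Fintype γ] in
/-- Re-nesting `Σ_a Σ_b Σ_c → Σ_c Σ_a Σ_b` (plumbing). [folklore] -/
theorem sum3_cab [Fintype α] [Fintype β] [Fintype γ] (Φ : α → β → γ → ℝ) :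
    (∑ a, ∑ b, ∑ c, Φ a b c) = ∑ c, ∑ a, ∑ b, Φ a b c := by
  rw [sum3_acb, sum_comm]

/-- **`T₁ ≥ 0`: `E f · E[gh] ≤ E[fgh]`** (FKG on `α` inside, then on `γ`; all in iterated-sum form). [this work] -/
theorem T1_bound [DistribLattice α] [DistribLattice γ] [Preorder β] (hA : IsFKGMeasure wA) (hB0 : ∀ b, 0 ≤ wB b)
    (hC : IsFKGMeasure wC) (hf0 : ∀ c a, 0 ≤ f c a) (hg0 : ∀ c b, 0 ≤ g c b) (hh0 : ∀ a b, 0 ≤ h a b)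
    (hfa : ∀ c, Monotone (f c)) (hfc : ∀ a, Monotone (fun c => f c a)) (hgc : ∀ b, Monotone (fun c => g c b))
    (hha : ∀ b, Monotone (fun a => h a b)) :
    (∑ c, wC c * FC wA f c) * (∑ b, wB b * (GB wC g b * HB wA h b)) ≤
      ∑ b, wB b * ∑ c, wC c * (g c b * ∑ a, wA a * (f c a * h a b)) := by
  rw [mul_sum]
  refine sum_le_sum fun b _ => ?_
  -- inner FKG on α: F_C(c)·H_B(b) ≤ Σ_a wA f(c,a) h(a,b)
  have s1 : (∑ c, wC c * (g c b * (FC wA f c * HB wA h b))) ≤ ∑ c, wC c * (g c b * ∑ a, wA a * (f c a * h a b)) :=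
    sum_le_sum fun c _ => mul_le_mul_of_nonneg_left (mul_le_mul_of_nonneg_left
      (fkg_sum hA (hf0 c) (fun a => hh0 a b) (hfa c) (hha b)) (hg0 c b)) (hC.nonneg c)
  -- outer FKG on γ: (Σ_c wC g(c,b))(Σ_c wC F_C(c)) ≤ Σ_c wC g(c,b) F_C(c)
  have s2 : GB wC g b * (∑ c, wC c * FC wA f c) ≤ ∑ c, wC c * (g c b * FC wA f c) :=
    fkg_sum hC (fun c => hg0 c b) (FC_nonneg hA.nonneg hf0) (hgc b) (FC_mono hA.nonneg hfc)
  have e1 : (∑ c, wC c * (g c b * (FC wA f c * HB wA h b))) = HB wA h b * ∑ c, wC c * (g c b * FC wA f c) := by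
    rw [mul_sum]; exact sum_congr rfl fun c _ => by ring
  have hHB := HB_nonneg hA.nonneg hh0 b
  have hwB := hB0 b
  calc (∑ c, wC c * FC wA f c) * (wB b * (GB wC g b * HB wA h b))
      = wB b * (HB wA h b * (GB wC g b * ∑ c, wC c * FC wA f c)) := by ring
    _ ≤ wB b * (HB wA h b * ∑ c, wC c * (g c b * FC wA f c)) :=
        mul_le_mul_of_nonneg_left (mul_le_mul_of_nonneg_left s2 hHB) hwB
    _ = wB b * ∑ c, wC c * (g c b * (FC wA f c * HB wA h b)) := by rw [e1]
    _ ≤ wB b * ∑ c, wC c * (g c b * ∑ a, wA a * (f c a * h a b)) := mul_le_mul_of_nonneg_left s1 hwB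

/-- **`T₂ ≥ 0`: `E_{c,a}[f·G_C·H_A] ≤ E[fgh]`** (FKG on `β` inside). [this work] -/
theorem T2_bound [DistribLattice β] (hA0 : ∀ a, 0 ≤ wA a) (hB : IsFKGMeasure wB) (hC0 : ∀ c, 0 ≤ wC c)
    (hf0 : ∀ c a, 0 ≤ f c a) (hg0 : ∀ c b, 0 ≤ g c b) (hh0 : ∀ a b, 0 ≤ h a b)
    (hgb : ∀ c, Monotone (g c)) (hhb : ∀ a, Monotone (h a)) :
    (∑ a, ∑ c, wA a * wC c * (f c a * (GC wB g c * HA wB h a))) ≤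
      ∑ a, ∑ c, wA a * wC c * (f c a * ∑ b, wB b * (g c b * h a b)) := by
  refine sum_le_sum fun a _ => sum_le_sum fun c _ => ?_
  exact mul_le_mul_of_nonneg_left (mul_le_mul_of_nonneg_left
    (fkg_sum hB (hg0 c) (hh0 a) (hgb c) (hhb a)) (hf0 c a)) (mul_nonneg (hA0 a) (hC0 c))

/-- **`T₃ ≥ 0`: `Cov_c(G_C, φ) ≥ 0`** (FKG on `γ`; `φ ≥ 0` increasing by cross-supermodularity). [this work] -/
theorem T3_bound [DistribLattice α] [Preorder β] [DistribLattice γ] (hA : IsFKGMeasure wA) (hB0 : ∀ b, 0 ≤ wB b)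
    (hC : IsFKGMeasure wC) (hf0 : ∀ c a, 0 ≤ f c a) (hg0 : ∀ c b, 0 ≤ g c b) (hh0 : ∀ a b, 0 ≤ h a b)
    (hfa : ∀ c, Monotone (f c)) (hfc : ∀ a, Monotone (fun c => f c a)) (hgc : ∀ b, Monotone (fun c => g c b))
    (hha : ∀ b, Monotone (fun a => h a b)) (hsm : ∀ c c', c ≤ c' → Monotone (fun a => f c' a - f c a)) :
    (∑ c, wC c * GC wB g c) * (∑ c, wC c * phi wA wB f h c) ≤ ∑ c, wC c * (GC wB g c * phi wA wB f h c) :=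
  fkg_sum hC (GC_nonneg hB0 hg0) (phi_nonneg hA hB0 hf0 hh0 hfa hha) (GC_mono hB0 hgc)
    (phi_mono hA hB0 hh0 hfc hha hsm)

variable (wA wB wC f g h)

/-- **THEOREM (triangle with a cross-supermodular member).**  `α, β, γ` finite distributive lattices with FKG probability weights
`wA, wB, wC`; `f : γ → α → ℝ`, `g : γ → β → ℝ`, `h : α → β → ℝ` nonnegative and coordinatewise monotone; `f` CROSS-SUPERMODULAR
(`a ↦ f c' a − f c a` monotone for `c ≤ c'`).  Then Sahi's `E_3(f,g,h) ≥ 0` under the product weight on `α × β × γ`.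
Proof: `E_3 = T₁ + T₂ + T₃` (`sahiE_three` and Fubini) with `T1_bound`, `T2_bound`, `T3_bound`. [this work] -/
theorem sahiE_three_nonneg_of_crossSupermodular [DistribLattice α] [DistribLattice β] [DistribLattice γ]
    (hA : IsFKGMeasure wA) (hB : IsFKGMeasure wB) (hC : IsFKGMeasure wC)
    (hf0 : ∀ c a, 0 ≤ f c a) (hg0 : ∀ c b, 0 ≤ g c b) (hh0 : ∀ a b, 0 ≤ h a b)
    (hfa : ∀ c, Monotone (f c)) (hfc : ∀ a, Monotone (fun c => f c a))
    (hgb : ∀ c, Monotone (g c)) (hgc : ∀ b, Monotone (fun c => g c b))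
    (hha : ∀ b, Monotone (fun a => h a b)) (hhb : ∀ a, Monotone (h a))
    (hsm : ∀ c c', c ≤ c' → Monotone (fun a => f c' a - f c a)) :
    0 ≤ sahiE (fun p : α × β × γ => wA p.1 * wB p.2.1 * wC p.2.2) 3
        ![fun p => f p.2.2 p.1, fun p => g p.2.2 p.2.1, fun p => h p.1 p.2.1] := by
  rw [sahiE_three]
  simp only [ex_prod3, Pi.mul_apply]
  -- E[fgh] in the two nestings used by T₁ and T₂
  have eFGH1 : (∑ a, ∑ b, ∑ c, wA a * wB b * wC c * (f c a * g c b * h a b)) =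
      ∑ b, wB b * ∑ c, wC c * (g c b * ∑ a, wA a * (f c a * h a b)) := by
    rw [sum3_bca]
    simp only [mul_sum]
    exact sum_congr rfl fun b _ => sum_congr rfl fun c _ => sum_congr rfl fun a _ => by ring
  have eFGH2 : (∑ a, ∑ b, ∑ c, wA a * wB b * wC c * (f c a * g c b * h a b)) =
      ∑ a, ∑ c, wA a * wC c * (f c a * ∑ b, wB b * (g c b * h a b)) := by
    rw [sum3_acb]
    simp only [mul_sum]
    exact sum_congr rfl fun a _ => sum_congr rfl fun c _ => sum_congr rfl fun b _ => by ring
  have eF : (∑ a, ∑ b, ∑ c, wA a * wB b * wC c * f c a) = ∑ c, wC c * FC wA f c := by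
    rw [drop_b wA wB wC hB.sum_eq_one fun a c => f c a, sum_comm]
    simp only [FC, mul_sum]
    exact sum_congr rfl fun c _ => sum_congr rfl fun a _ => by ring
  have eG : (∑ a, ∑ b, ∑ c, wA a * wB b * wC c * g c b) = ∑ c, wC c * GC wB g c := by
    rw [drop_a wA wB wC hA.sum_eq_one fun b c => g c b, sum_comm]
    simp only [GC, mul_sum]
    exact sum_congr rfl fun c _ => sum_congr rfl fun b _ => by ring
  have eH : (∑ a, ∑ b, ∑ c, wA a * wB b * wC c * h a b) = ∑ a, wA a * HA wB h a := by
    rw [drop_c wA wB wC hC.sum_eq_one h]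
    simp only [HA, mul_sum]
    exact sum_congr rfl fun a _ => sum_congr rfl fun b _ => by ring
  have eGH : (∑ a, ∑ b, ∑ c, wA a * wB b * wC c * (g c b * h a b)) = ∑ b, wB b * (GB wC g b * HB wA h b) := by
    rw [sum3_bca]
    refine sum_congr rfl fun b _ => ?_
    rw [GB, HB, sum_mul_sum, mul_sum]
    refine sum_congr rfl fun c _ => ?_
    rw [mul_sum]
    exact sum_congr rfl fun a _ => by ring
  have eFH : (∑ a, ∑ b, ∑ c, wA a * wB b * wC c * (f c a * h a b)) = ∑ c, wC c * ∑ a, wA a * (f c a * HA wB h a) := by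
    rw [sum3_cab]
    simp only [HA, mul_sum]
    exact sum_congr rfl fun c _ => sum_congr rfl fun a _ => sum_congr rfl fun b _ => by ring
  have eFG : (∑ a, ∑ b, ∑ c, wA a * wB b * wC c * (f c a * g c b)) = ∑ c, wC c * (FC wA f c * GC wB g c) := by
    rw [sum3_cab]
    refine sum_congr rfl fun c _ => ?_
    rw [FC, GC, sum_mul_sum, mul_sum]
    refine sum_congr rfl fun a _ => ?_
    rw [mul_sum]
    exact sum_congr rfl fun b _ => by ring
  -- the mixed moment M = E_{c,a}[f G_C H_A] in the nesting of T₃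
  have eM : (∑ a, ∑ c, wA a * wC c * (f c a * (GC wB g c * HA wB h a))) =
      ∑ c, wC c * (GC wB g c * ∑ a, wA a * (f c a * HA wB h a)) := by
    rw [sum_comm]
    simp only [mul_sum]
    exact sum_congr rfl fun c _ => sum_congr rfl fun a _ => by ring
  -- T₃ in covariance form
  have ePhi1 : (∑ c, wC c * (GC wB g c * phi wA wB f h c)) =
      (∑ c, wC c * (GC wB g c * ∑ a, wA a * (f c a * HA wB h a)))
        - (∑ a, wA a * HA wB h a) * ∑ c, wC c * (FC wA f c * GC wB g c) := by
    have pt : ∀ c, wC c * (GC wB g c * phi wA wB f h c) = wC c * (GC wB g c * ∑ a, wA a * (f c a * HA wB h a))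
        - (∑ a, wA a * HA wB h a) * (wC c * (FC wA f c * GC wB g c)) := fun c => by simp only [phi]; ring
    simp only [pt, sum_sub_distrib, ← mul_sum]
  have ePhi2 : (∑ c, wC c * phi wA wB f h c) =
      (∑ c, wC c * ∑ a, wA a * (f c a * HA wB h a)) - (∑ a, wA a * HA wB h a) * ∑ c, wC c * FC wA f c := by
    have pt : ∀ c, wC c * phi wA wB f h c = wC c * (∑ a, wA a * (f c a * HA wB h a))
        - (∑ a, wA a * HA wB h a) * (wC c * FC wA f c) := fun c => by simp only [phi]; ring
    simp only [pt, sum_sub_distrib, ← mul_sum]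
  have b1 := T1_bound hA hB.nonneg hC hf0 hg0 hh0 hfa hfc hgc hha
  have b2 := T2_bound hA.nonneg hB hC.nonneg hf0 hg0 hh0 hgb hhb
  have b3 := T3_bound hA hB.nonneg hC hf0 hg0 hh0 hfa hfc hgc hha hsm
  rw [ePhi1, ePhi2] at b3
  rw [← eFGH1] at b1
  rw [← eFGH2, eM] at b2
  rw [eF, eG, eH, eGH, eFH, eFG]
  nlinarith [b1, b2, b3]

/-- A PRODUCT member `f(c,a) = φ(c)ψ(a)` (`φ, ψ ≥ 0` monotone) is cross-supermodular, hence **`E_3(φ⊗ψ, g, h) ≥ 0`** on the triangle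
class for arbitrary nonnegative monotone `g, h` and arbitrary FKG block weights. [this work] -/
theorem sahiE_three_nonneg_of_productMember [DistribLattice α] [DistribLattice β] [DistribLattice γ]
    (hA : IsFKGMeasure wA) (hB : IsFKGMeasure wB) (hC : IsFKGMeasure wC) (φ : γ → ℝ) (ψ : α → ℝ)
    (hφ0 : ∀ c, 0 ≤ φ c) (hψ0 : ∀ a, 0 ≤ ψ a) (hφ : Monotone φ) (hψ : Monotone ψ)
    (hg0 : ∀ c b, 0 ≤ g c b) (hh0 : ∀ a b, 0 ≤ h a b)
    (hgb : ∀ c, Monotone (g c)) (hgc : ∀ b, Monotone (fun c => g c b))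
    (hha : ∀ b, Monotone (fun a => h a b)) (hhb : ∀ a, Monotone (h a)) :
    0 ≤ sahiE (fun p : α × β × γ => wA p.1 * wB p.2.1 * wC p.2.2) 3
        ![fun p => φ p.2.2 * ψ p.1, fun p => g p.2.2 p.2.1, fun p => h p.1 p.2.1] := by
  refine sahiE_three_nonneg_of_crossSupermodular wA wB wC (fun c a => φ c * ψ a) g h hA hB hC
    (fun c a => mul_nonneg (hφ0 c) (hψ0 a)) hg0 hh0 (fun c => ?_) (fun a => ?_) hgb hgc hha hhb (fun c c' hcc => ?_)
  · exact fun a a' haa => mul_le_mul_of_nonneg_left (hψ haa) (hφ0 c)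
  · exact fun c c' hcc => mul_le_mul_of_nonneg_right (hφ hcc) (hψ0 a)
  · intro a a' haa
    have e : ∀ x, φ c' * ψ x - φ c * ψ x = (φ c' - φ c) * ψ x := fun x => by ring
    simp only [e]
    exact mul_le_mul_of_nonneg_left (hψ haa) (sub_nonneg.mpr (hφ hcc))

/-- Relabelling `(a,b,c) ↦ (b,a,c)` (plumbing for the `g`-form). [folklore] -/
def swapEquiv : α × β × γ ≃ β × α × γ where
  toFun p := (p.2.1, p.1, p.2.2)
  invFun q := (q.2.1, q.1, q.2.2)
  left_inv _ := rfl
  right_inv _ := rfl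

/-- Relabelling `(a,b,c) ↦ (b,c,a)` (plumbing for the `h`-form). [folklore] -/
def rotEquiv : α × β × γ ≃ β × γ × α where
  toFun p := (p.2.1, p.2.2, p.1)
  invFun q := (q.2.2, q.1, q.2.1)
  left_inv _ := rfl
  right_inv _ := rfl

/-- The transposition `(0 1)` of `Fin 3` as an explicit table. [folklore] -/
def perm102 : Equiv.Perm (Fin 3) := ⟨![1, 0, 2], ![1, 0, 2], by decide, by decide⟩

/-- The `3`-cycle `0 ↦ 2 ↦ 1 ↦ 0` of `Fin 3` as an explicit table. [folklore] -/
def perm201 : Equiv.Perm (Fin 3) := ⟨![2, 0, 1], ![1, 2, 0], by decide, by decide⟩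

/-- **`g`-form**: the same conclusion when the member `g(c,b)` (blocks `γ, β`) is the cross-supermodular one. [this work] -/
theorem sahiE_three_nonneg_of_crossSupermodular_g [DistribLattice α] [DistribLattice β] [DistribLattice γ]
    (hA : IsFKGMeasure wA) (hB : IsFKGMeasure wB) (hC : IsFKGMeasure wC)
    (hf0 : ∀ c a, 0 ≤ f c a) (hg0 : ∀ c b, 0 ≤ g c b) (hh0 : ∀ a b, 0 ≤ h a b)
    (hfa : ∀ c, Monotone (f c)) (hfc : ∀ a, Monotone (fun c => f c a))
    (hgb : ∀ c, Monotone (g c)) (hgc : ∀ b, Monotone (fun c => g c b))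
    (hha : ∀ b, Monotone (fun a => h a b)) (hhb : ∀ a, Monotone (h a))
    (hsm : ∀ c c', c ≤ c' → Monotone (fun b => g c' b - g c b)) :
    0 ≤ sahiE (fun p : α × β × γ => wA p.1 * wB p.2.1 * wC p.2.2) 3
        ![fun p => f p.2.2 p.1, fun p => g p.2.2 p.2.1, fun p => h p.1 p.2.1] := by
  have key := sahiE_three_nonneg_of_crossSupermodular wB wA wC g f (fun b a => h a b) hB hA hC hg0 hf0
    (fun b a => hh0 a b) hgb hgc hfa hfc hhb hha hsm
  rw [← sahiE_comp_equiv (swapEquiv (α := α) (β := β) (γ := γ))] at key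
  have hμ : ((fun p : β × α × γ => wB p.1 * wA p.2.1 * wC p.2.2) ∘ swapEquiv (α := α) (β := β) (γ := γ)) =
      fun p : α × β × γ => wA p.1 * wB p.2.1 * wC p.2.2 := by
    funext p; simp only [Function.comp, swapEquiv, Equiv.coe_fn_mk]; ring
  have hF : (fun i => (![fun p : β × α × γ => g p.2.2 p.1, fun p => f p.2.2 p.2.1, fun p => h p.2.1 p.1] i) ∘
      swapEquiv (α := α) (β := β) (γ := γ)) =
      fun i => (![fun p : α × β × γ => f p.2.2 p.1, fun p => g p.2.2 p.2.1, fun p => h p.1 p.2.1]) (perm102 i) := by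
    funext i; fin_cases i <;> rfl
  rw [hμ, hF, sahiE_comp_perm] at key
  exact key

/-- **`h`-form**: the same conclusion when the member `h(a,b)` (blocks `α, β`) is the cross-supermodular one. [this work] -/
theorem sahiE_three_nonneg_of_crossSupermodular_h [DistribLattice α] [DistribLattice β] [DistribLattice γ]
    (hA : IsFKGMeasure wA) (hB : IsFKGMeasure wB) (hC : IsFKGMeasure wC)
    (hf0 : ∀ c a, 0 ≤ f c a) (hg0 : ∀ c b, 0 ≤ g c b) (hh0 : ∀ a b, 0 ≤ h a b)
    (hfa : ∀ c, Monotone (f c)) (hfc : ∀ a, Monotone (fun c => f c a))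
    (hgb : ∀ c, Monotone (g c)) (hgc : ∀ b, Monotone (fun c => g c b))
    (hha : ∀ b, Monotone (fun a => h a b)) (hhb : ∀ a, Monotone (h a))
    (hsm : ∀ a a', a ≤ a' → Monotone (fun b => h a' b - h a b)) :
    0 ≤ sahiE (fun p : α × β × γ => wA p.1 * wB p.2.1 * wC p.2.2) 3
        ![fun p => f p.2.2 p.1, fun p => g p.2.2 p.2.1, fun p => h p.1 p.2.1] := by
  have key := sahiE_three_nonneg_of_crossSupermodular wB wC wA h (fun a c => f c a) (fun b c => g c b) hB hC hA hh0
    (fun a c => hf0 c a) (fun b c => hg0 c b) hhb hha hfc hfa hgb hgc hsm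
  rw [← sahiE_comp_equiv (rotEquiv (α := α) (β := β) (γ := γ))] at key
  have hμ : ((fun p : β × γ × α => wB p.1 * wC p.2.1 * wA p.2.2) ∘ rotEquiv (α := α) (β := β) (γ := γ)) =
      fun p : α × β × γ => wA p.1 * wB p.2.1 * wC p.2.2 := by
    funext p; simp only [Function.comp, rotEquiv, Equiv.coe_fn_mk]; ring
  have hF : (fun i => (![fun p : β × γ × α => h p.2.2 p.1, fun p => f p.2.1 p.2.2, fun p => g p.2.1 p.1] i) ∘
      rotEquiv (α := α) (β := β) (γ := γ)) =
      fun i => (![fun p : α × β × γ => f p.2.2 p.1, fun p => g p.2.2 p.2.1, fun p => h p.1 p.2.1]) (perm201 i) := by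
    funext i; fin_cases i <;> rfl
  rw [hμ, hF, sahiE_comp_perm] at key
  exact key

end Main

section Cubes

variable {A B C : Type} [Fintype A] [Fintype B] [Fintype C]

/-- **Three Boolean cubes with product (Bernoulli) measures.**  `f : 2^C × 2^A → ℝ`, `g : 2^C × 2^B → ℝ`, `h : 2^A × 2^B → ℝ`
nonnegative coordinatewise monotone, `f` cross-supermodular ⇒ `E_3(f,g,h) ≥ 0` under `μ_{p_A} ⊗ μ_{p_B} ⊗ μ_{p_C}` — the law-level
statement of the one-arm programme's triangle class (SAHI-ROUTE §4.16(d)) for this stratum, all block dimensions. [this work] -/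
theorem sahiE_three_nonneg_cubes_of_crossSupermodular (pA : A → unitInterval) (pB : B → unitInterval) (pC : C → unitInterval)
    (f : Set C → Set A → ℝ) (g : Set C → Set B → ℝ) (h : Set A → Set B → ℝ)
    (hf0 : ∀ c a, 0 ≤ f c a) (hg0 : ∀ c b, 0 ≤ g c b) (hh0 : ∀ a b, 0 ≤ h a b)
    (hfa : ∀ c, Monotone (f c)) (hfc : ∀ a, Monotone (fun c => f c a))
    (hgb : ∀ c, Monotone (g c)) (hgc : ∀ b, Monotone (fun c => g c b))
    (hha : ∀ b, Monotone (fun a => h a b)) (hhb : ∀ a, Monotone (h a))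
    (hsm : ∀ c c', c ≤ c' → Monotone (fun a => f c' a - f c a)) :
    0 ≤ sahiE (fun p : Set A × Set B × Set C =>
        bernoulliWeight pA p.1 * bernoulliWeight pB p.2.1 * bernoulliWeight pC p.2.2) 3
        ![fun p => f p.2.2 p.1, fun p => g p.2.2 p.2.1, fun p => h p.1 p.2.1] :=
  sahiE_three_nonneg_of_crossSupermodular (bernoulliWeight pA) (bernoulliWeight pB) (bernoulliWeight pC) f g h
    (isFKGMeasure_bernoulliWeight pA) (isFKGMeasure_bernoulliWeight pB) (isFKGMeasure_bernoulliWeight pC)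
    hf0 hg0 hh0 hfa hfc hgb hgc hha hhb hsm

end Cubes

end SahiTriangleSupermodular

end Summit.CriticalPhenomena.PercolationContinuityZ3.Theorems
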